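import Summits.RiemannHypothesis.RiemannHypothesis.Theorems.GroundBartaEvenWinsBeyondArchDeflationMajorant
import Literature.NumberTheory.LFunctions.WeilArchDensityPanels
import Literature.NumberTheory.LFunctions.WeilWindowSuzukiProofs
import HarnessLib

/-!
# RiemannHypothesis / GroundBarta — rung 4 (`EvenWinsBeyondArch`, stmt-RiemannHypothesis-18807 / 18085):
# the deflated Temple L-side, XIV — the window image of `𝟙_{[-c,c]}·g`, SPLIT into regular integrals and the edge logarithm

Helper file (`--supports stmt-RiemannHypothesis-18807`), RH-free, Mathlib + landed tree files only, no definitions,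
no named facts.  Prover B, speedrun unit `sr-gb-rung-b` (gen 4).  The R-layer of the programme (files V–VII, XIII) needs
VALIDATED ENCLOSURES of the window images `F_i = L v_i` of the trial vectors `v_i = 𝟙_{[-c,c]} g_i` (`g_i` polynomial), whose
only transcendental and only singular ingredient is the archimedean layer

  `A(y) = ∫_{(0,∞)} ρ(t) (2v(y) − v(y−t) − v(y+t)) dt`,   `ρ(t) = e^{t/2}/(2 sinh t) ~ 1/(2t)`.

This file realifies the slice (`dt_archSlice_ofReal`) and proves, for `0 ≤ y < c` (the other half of the window by the
reflection `dt_archSlice_reflect`), the EXACT SPLIT (`dt_archImage_split`)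

  `A(y) = ∫_{(0,c−y]} G(t)·E(y,t) dt + ∫_{(c−y,c+y]} G(t)·H(y,t) dt + g(y)·(Ψ(c−y) + Ψ(c+y))`,

  `G(t) = t ρ(t)` (`weilArchDensityG`, analytic, `G(0) = ½`),  `E(y,t) = (2g(y) − g(y−t) − g(y+t))/t`,
  `H(y,t) = (g(y) − g(y−t))/t`,  `Ψ(L) = ∫_{(L,∞)} ρ`,

in which, for a polynomial `g`, `E` and `H` are POLYNOMIALS in `(y, t)` (exact rational data), the two integrals are regular
(bounded integrands on compact ranges whose endpoints `c ∓ y` move affinely with `y` — panel Taylor models of `G`,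
`WeilArchDensityPanels.lean`, are the universal input), and the whole edge singularity sits in the closed-form factor
`Ψ(c − y) = −½ log(c − y) + (log 2 + π/4) + O(c − y)` (`WeilArchDensityTail.lean`).  Also: the three pointwise regimes of
the second difference (`dt_windowDiff_of_near/_mid/_far`), integrability of the real slice (`dt_integrableOn_archSliceReal`),
and the realified pole coefficients (`dt_poleCoeff_cosh/_sinh`).

References: E. Bombieri, Rend. Mat. Acc. Lincei (9) 11 (2000) 183–233, Thm 2 (the archimedean density) [Bombieri2000Weil].
-/

set_option linter.dupNamespace false

noncomputable section

open MeasureTheory Set Filter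
open scoped Topology BigOperators

namespace Summit.RiemannHypothesis.RiemannHypothesis.Theorems.EvenWinsBeyondArch

open Literature.NumberTheory.LFunctions

variable {c : ℝ} {g : ℝ → ℝ} {v : ℝ → ℂ}

/-! ## The windowed profile and the three regimes of its second difference -/

/-- Inside the window the trial vector is the profile. -/
theorem dt_window_indicator_of_mem {x : ℝ} (hx : x ∈ Icc (-c) c) : (Icc (-c) c).indicator g x = g x :=
  indicator_of_mem hx _

/-- Outside the window the trial vector vanishes. -/
theorem dt_window_indicator_of_not_mem {x : ℝ} (hx : x ∉ Icc (-c) c) : (Icc (-c) c).indicator g x = 0 :=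
  indicator_of_notMem hx _

/-- **Near regime** `0 < t ≤ c − y` (`0 ≤ y < c`): both shifted copies stay in the window,
`2ĝ(y) − ĝ(y−t) − ĝ(y+t) = 2g(y) − g(y−t) − g(y+t)`. -/
theorem dt_windowDiff_of_near {y t : ℝ} (hy : y ∈ Ico 0 c) (ht : t ∈ Ioc 0 (c - y)) :
    2 * (Icc (-c) c).indicator g y - (Icc (-c) c).indicator g (y - t) - (Icc (-c) c).indicator g (y + t) =
      2 * g y - g (y - t) - g (y + t) := by
  obtain ⟨hy0, hyc⟩ := hy
  obtain ⟨ht0, htL⟩ := ht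
  rw [dt_window_indicator_of_mem ⟨by linarith, by linarith⟩,
    dt_window_indicator_of_mem ⟨by linarith, by linarith⟩, dt_window_indicator_of_mem ⟨by linarith, by linarith⟩]

/-- **Middle regime** `c − y < t ≤ c + y`: the right copy has left the window,
`2ĝ(y) − ĝ(y−t) − ĝ(y+t) = 2g(y) − g(y−t)`. -/
theorem dt_windowDiff_of_mid {y t : ℝ} (hy : y ∈ Ico 0 c) (ht : t ∈ Ioc (c - y) (c + y)) :
    2 * (Icc (-c) c).indicator g y - (Icc (-c) c).indicator g (y - t) - (Icc (-c) c).indicator g (y + t) =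
      2 * g y - g (y - t) := by
  obtain ⟨hy0, hyc⟩ := hy
  obtain ⟨htL, htU⟩ := ht
  rw [dt_window_indicator_of_mem ⟨by linarith, by linarith⟩,
    dt_window_indicator_of_mem ⟨by linarith, by linarith⟩,
    dt_window_indicator_of_not_mem (fun h ↦ by linarith [h.2]), sub_zero]

/-- **Far regime** `t > c + y`: both copies have left, `2ĝ(y) − ĝ(y−t) − ĝ(y+t) = 2g(y)`. -/
theorem dt_windowDiff_of_far {y t : ℝ} (hy : y ∈ Ico 0 c) (ht : t ∈ Ioi (c + y)) :
    2 * (Icc (-c) c).indicator g y - (Icc (-c) c).indicator g (y - t) - (Icc (-c) c).indicator g (y + t) =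
      2 * g y := by
  obtain ⟨hy0, hyc⟩ := hy
  have ht' : c + y < t := ht
  rw [dt_window_indicator_of_mem ⟨by linarith, by linarith⟩,
    dt_window_indicator_of_not_mem (fun h ↦ by linarith [h.1]),
    dt_window_indicator_of_not_mem (fun h ↦ by linarith [h.2]), sub_zero, sub_zero]

/-! ## The slice of the archimedean layer is real -/

/-- **Realification of the slice**: with `v = (𝟙_{[-c,c]} g : ℂ)`,
`ρ(t)·(2v(y) − v(y−t) − v(y+t)) = ↑(ρ(t)·(2ĝ(y) − ĝ(y−t) − ĝ(y+t)))`. -/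
theorem dt_archSlice_ofReal (hv : ∀ x, v x = (((Icc (-c) c).indicator g x : ℝ) : ℂ)) (y t : ℝ) :
    (weilArchDensity t : ℂ) * (2 * v y - v (y - t) - v (y + t)) =
      ((weilArchDensity t * (2 * (Icc (-c) c).indicator g y - (Icc (-c) c).indicator g (y - t) -
        (Icc (-c) c).indicator g (y + t)) : ℝ) : ℂ) := by
  rw [hv, hv, hv]; push_cast; ring

/-- **Reflection**: the slice of `v` at `y` is the slice of `x ↦ v(−x)` at `−y` (so the split below, stated on
`[0, c)`, covers `(−c, 0]` after replacing `g` by `g ∘ neg`). -/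
theorem dt_archSlice_reflect (w : ℝ → ℂ) (y : ℝ) :
    (fun t ↦ (weilArchDensity t : ℂ) * (2 * w y - w (y - t) - w (y + t))) =
      fun t ↦ (weilArchDensity t : ℂ) * (2 * (fun x ↦ w (-x)) (-y) - (fun x ↦ w (-x)) (-y - t) -
        (fun x ↦ w (-x)) (-y + t)) := by
  funext t
  simp only [neg_neg, neg_sub, neg_add_rev]
  rw [show t - -y = y + t by ring, show -t + y = y - t by ring]
  ring

/-- The reflected profile has the reflected window function (the window is symmetric). -/
theorem dt_window_indicator_reflect (x : ℝ) :
    (Icc (-c) c).indicator g (-x) = (Icc (-c) c).indicator (fun z ↦ g (-z)) x := by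
  by_cases hx : x ∈ Icc (-c) c
  · have hx' : -x ∈ Icc (-c) c := ⟨by linarith [hx.2], by linarith [hx.1]⟩
    rw [indicator_of_mem hx, indicator_of_mem hx']
  · have hx' : -x ∉ Icc (-c) c := fun h ↦ hx ⟨by linarith [h.2], by linarith [h.1]⟩
    rw [indicator_of_notMem hx, indicator_of_notMem hx']

/-! ## Integrability of the real slice -/

/-- The real slice `t ↦ ρ(t)(2ĝ(y) − ĝ(y−t) − ĝ(y+t))` is measurable (for continuous `g`). -/
theorem dt_measurable_archSliceReal (hg : Continuous g) (y : ℝ) :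
    Measurable fun t ↦ weilArchDensity t * (2 * (Icc (-c) c).indicator g y -
      (Icc (-c) c).indicator g (y - t) - (Icc (-c) c).indicator g (y + t)) := by
  have hm : Measurable ((Icc (-c) c).indicator g) := hg.measurable.indicator measurableSet_Icc
  exact measurable_weilArchDensity.mul ((measurable_const.sub (hm.comp (measurable_const.sub measurable_id))).sub
    (hm.comp (measurable_const.add measurable_id)))

/-- **The real slice is integrable on `(0, ∞)`** for `|y| < c` and `g ∈ C²` (file VII's majorant). -/
theorem dt_integrableOn_archSliceReal (hc : 0 < c) (hg : ContDiff ℝ 2 g)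
    (hv : ∀ x, v x = (((Icc (-c) c).indicator g x : ℝ) : ℂ)) {y : ℝ} (hy : y ∈ Ioo (-c) c) :
    IntegrableOn (fun t ↦ weilArchDensity t * (2 * (Icc (-c) c).indicator g y -
      (Icc (-c) c).indicator g (y - t) - (Icc (-c) c).indicator g (y + t))) (Ioi 0) := by
  obtain ⟨m, -, hI, -⟩ := dt_exists_majorant_of_contDiff hc hg hv
  refine Integrable.mono' (hI y hy) (dt_measurable_archSliceReal hg.continuous y).aestronglyMeasurable ?_
  refine (ae_restrict_iff' measurableSet_Ioi).2 (Eventually.of_forall fun t (ht : 0 < t) ↦ ?_)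
  have e : 2 * v y - v (y - t) - v (y + t) = ((2 * (Icc (-c) c).indicator g y -
      (Icc (-c) c).indicator g (y - t) - (Icc (-c) c).indicator g (y + t) : ℝ) : ℂ) := by
    rw [hv, hv, hv]; push_cast; ring
  rw [Real.norm_eq_abs, abs_mul, abs_of_pos (weilArchDensity_pos ht), e, Complex.norm_real, Real.norm_eq_abs]

/-! ## The split of the archimedean layer on `[0, c)` -/

/-- `ρ(t)·X = G(t)·(X/t)` for `t > 0`. -/
theorem dt_rho_mul_eq_G_mul_div {t : ℝ} (ht : 0 < t) (X : ℝ) :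
    weilArchDensity t * X = weilArchDensityG t * (X / t) := by
  rw [← weilArchDensity_mul_mul ht, mul_div_cancel₀ _ ht.ne']

/-- **THE SPLIT of the window image's archimedean layer (real form).**  For `0 < c`, `g ∈ C²`, `0 ≤ y < c`:
`∫_{(0,∞)} ρ(t)(2ĝ(y) − ĝ(y−t) − ĝ(y+t)) dt = ∫_{(0,c−y]} G·E + ∫_{(c−y,c+y]} G·H + g(y)(Ψ(c−y) + Ψ(c+y))`
with `E = (2g(y) − g(y−t) − g(y+t))/t`, `H = (g(y) − g(y−t))/t`, `Ψ(L) = ∫_{(L,∞)} ρ`.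
[cite: Bombieri2000Weil, Thm 2 (the archimedean density)] -/
theorem dt_archImage_split_real (hc : 0 < c) (hg : ContDiff ℝ 2 g)
    (hv : ∀ x, v x = (((Icc (-c) c).indicator g x : ℝ) : ℂ)) {y : ℝ} (hy : y ∈ Ico 0 c) :
    ∫ t in Ioi 0, weilArchDensity t * (2 * (Icc (-c) c).indicator g y -
        (Icc (-c) c).indicator g (y - t) - (Icc (-c) c).indicator g (y + t)) =
      (∫ t in Ioc 0 (c - y), weilArchDensityG t * ((2 * g y - g (y - t) - g (y + t)) / t)) +
        (∫ t in Ioc (c - y) (c + y), weilArchDensityG t * ((g y - g (y - t)) / t)) +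
        g y * ((∫ t in Ioi (c - y), weilArchDensity t) + ∫ t in Ioi (c + y), weilArchDensity t) := by
  obtain ⟨hy0, hyc⟩ := hy
  have hL : 0 < c - y := by linarith
  have hLU : c - y ≤ c + y := by linarith
  set R : ℝ → ℝ := fun t ↦ weilArchDensity t * (2 * (Icc (-c) c).indicator g y -
    (Icc (-c) c).indicator g (y - t) - (Icc (-c) c).indicator g (y + t)) with hR
  have hRI : IntegrableOn R (Ioi 0) :=
    dt_integrableOn_archSliceReal hc hg hv ⟨by linarith, hyc⟩
  -- integrability of `ρ` on the far ranges
  have hρL : IntegrableOn weilArchDensity (Ioi (c - y)) := integrableOn_weilArchDensity_Ioi hL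
  have hρU : IntegrableOn weilArchDensity (Ioi (c + y)) := integrableOn_weilArchDensity_Ioi (by linarith)
  have hρM : IntegrableOn weilArchDensity (Ioc (c - y) (c + y)) := hρL.mono_set Ioc_subset_Ioi_self
  -- first split: `(0,∞) = (0, c−y] ∪ (c−y, ∞)`
  have hs1 : ∫ t in Ioi 0, R t = (∫ t in Ioc 0 (c - y), R t) + ∫ t in Ioi (c - y), R t := by
    rw [← setIntegral_union Ioc_disjoint_Ioi_same measurableSet_Ioi (hRI.mono_set Ioc_subset_Ioi_self)
      (hRI.mono_set (Ioi_subset_Ioi hL.le)), Ioc_union_Ioi_eq_Ioi hL.le]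
  -- second split: `(c−y, ∞) = (c−y, c+y] ∪ (c+y, ∞)`
  have hs2 : ∫ t in Ioi (c - y), R t = (∫ t in Ioc (c - y) (c + y), R t) + ∫ t in Ioi (c + y), R t := by
    rw [← setIntegral_union Ioc_disjoint_Ioi_same measurableSet_Ioi
      (hRI.mono_set (Ioc_subset_Ioi_self.trans (Ioi_subset_Ioi hL.le)))
      (hRI.mono_set (Ioi_subset_Ioi (by linarith))), Ioc_union_Ioi_eq_Ioi hLU]
  -- the tail `Ψ(c−y) = ∫_{(c−y,c+y]} ρ + Ψ(c+y)`
  have hs3 : ∫ t in Ioi (c - y), weilArchDensity t =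
      (∫ t in Ioc (c - y) (c + y), weilArchDensity t) + ∫ t in Ioi (c + y), weilArchDensity t := by
    rw [← setIntegral_union Ioc_disjoint_Ioi_same measurableSet_Ioi hρM hρU, Ioc_union_Ioi_eq_Ioi hLU]
  -- piece 1: near regime
  have hp1 : ∫ t in Ioc 0 (c - y), R t =
      ∫ t in Ioc 0 (c - y), weilArchDensityG t * ((2 * g y - g (y - t) - g (y + t)) / t) := by
    refine setIntegral_congr_fun measurableSet_Ioc fun t ht ↦ ?_
    simp only [hR]
    rw [dt_windowDiff_of_near ⟨hy0, hyc⟩ ht, dt_rho_mul_eq_G_mul_div ht.1]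
  -- piece 2: middle regime
  have hp2 : ∫ t in Ioc (c - y) (c + y), R t =
      g y * (∫ t in Ioc (c - y) (c + y), weilArchDensity t) +
        ∫ t in Ioc (c - y) (c + y), weilArchDensityG t * ((g y - g (y - t)) / t) := by
    have heq : EqOn R (fun t ↦ g y * weilArchDensity t + weilArchDensityG t * ((g y - g (y - t)) / t))
        (Ioc (c - y) (c + y)) := by
      intro t ht
      simp only [hR]
      rw [dt_windowDiff_of_mid ⟨hy0, hyc⟩ ht, show 2 * g y - g (y - t) = g y + (g y - g (y - t)) by ring, mul_add,
        dt_rho_mul_eq_G_mul_div (hL.trans ht.1) (g y - g (y - t))]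
      ring
    have hI1 : IntegrableOn (fun t ↦ g y * weilArchDensity t) (Ioc (c - y) (c + y)) := hρM.const_mul _
    have hI2 : IntegrableOn (fun t ↦ weilArchDensityG t * ((g y - g (y - t)) / t)) (Ioc (c - y) (c + y)) := by
      have hRm : IntegrableOn R (Ioc (c - y) (c + y)) :=
        hRI.mono_set (Ioc_subset_Ioi_self.trans (Ioi_subset_Ioi hL.le))
      have h := (hRm.congr_fun heq measurableSet_Ioc).sub hI1
      refine h.congr_fun (fun t _ ↦ ?_) measurableSet_Ioc
      simp only [Pi.sub_apply]
      ring
    rw [setIntegral_congr_fun measurableSet_Ioc heq, integral_add hI1 hI2, integral_const_mul]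
  -- piece 3: far regime
  have hp3 : ∫ t in Ioi (c + y), R t = 2 * g y * ∫ t in Ioi (c + y), weilArchDensity t := by
    rw [← integral_const_mul]
    refine setIntegral_congr_fun measurableSet_Ioi fun t ht ↦ ?_
    simp only [hR]
    rw [dt_windowDiff_of_far ⟨hy0, hyc⟩ ht]
    ring
  rw [hs1, hs2, hp1, hp2, hp3, hs3]
  ring

/-- **THE SPLIT, complex form** (the shape of the window-image formula `hF` of files V–XI): for `0 ≤ y < c`,
`∫_{(0,∞)} ρ(t)(2v(y) − v(y−t) − v(y+t)) dt = ↑(∫_{(0,c−y]} G·E + ∫_{(c−y,c+y]} G·H + g(y)(Ψ(c−y) + Ψ(c+y)))`.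
[cite: Bombieri2000Weil, Thm 2 (the archimedean density)] -/
theorem dt_archImage_split (hc : 0 < c) (hg : ContDiff ℝ 2 g)
    (hv : ∀ x, v x = (((Icc (-c) c).indicator g x : ℝ) : ℂ)) {y : ℝ} (hy : y ∈ Ico 0 c) :
    ∫ t in Ioi 0, (weilArchDensity t : ℂ) * (2 * v y - v (y - t) - v (y + t)) =
      (((∫ t in Ioc 0 (c - y), weilArchDensityG t * ((2 * g y - g (y - t) - g (y + t)) / t)) +
        (∫ t in Ioc (c - y) (c + y), weilArchDensityG t * ((g y - g (y - t)) / t)) +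
        g y * ((∫ t in Ioi (c - y), weilArchDensity t) + ∫ t in Ioi (c + y), weilArchDensity t) : ℝ) : ℂ) := by
  rw [← dt_archImage_split_real hc hg hv hy, ← integral_complex_ofReal]
  exact integral_congr_ae (Eventually.of_forall fun t ↦ dt_archSlice_ofReal hv y t)

/-- **The split on the left half** `−c < y ≤ 0`, via reflection: the same formula for the profile `g ∘ neg` at `−y`.
[cite: Bombieri2000Weil, Thm 2 (the archimedean density)] -/
theorem dt_archImage_split_neg (hc : 0 < c) (hg : ContDiff ℝ 2 g)
    (hv : ∀ x, v x = (((Icc (-c) c).indicator g x : ℝ) : ℂ)) {y : ℝ} (hy : y ∈ Ioc (-c) 0) :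
    ∫ t in Ioi 0, (weilArchDensity t : ℂ) * (2 * v y - v (y - t) - v (y + t)) =
      (((∫ t in Ioc 0 (c + y), weilArchDensityG t * ((2 * g y - g (y + t) - g (y - t)) / t)) +
        (∫ t in Ioc (c + y) (c - y), weilArchDensityG t * ((g y - g (y + t)) / t)) +
        g y * ((∫ t in Ioi (c + y), weilArchDensity t) + ∫ t in Ioi (c - y), weilArchDensity t) : ℝ) : ℂ) := by
  have hw : ∀ x, (fun z ↦ v (-z)) x = (((Icc (-c) c).indicator (fun z ↦ g (-z)) x : ℝ) : ℂ) := fun x ↦ by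
    simp only [hv, dt_window_indicator_reflect]
  have hgn : ContDiff ℝ 2 (fun z ↦ g (-z)) := hg.comp contDiff_neg
  have hy' : -y ∈ Ico 0 c := ⟨by linarith [hy.2], by linarith [hy.1]⟩
  have h := dt_archImage_split hc hgn hw hy'
  have e1 : (fun t : ℝ ↦ weilArchDensityG t * ((2 * g (-(-y)) - g (-(-y - t)) - g (-(-y + t))) / t)) =
      fun t ↦ weilArchDensityG t * ((2 * g y - g (y + t) - g (y - t)) / t) := by
    funext t
    rw [neg_neg, show -(-y - t) = y + t by ring, show -(-y + t) = y - t by ring]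
  have e2 : (fun t : ℝ ↦ weilArchDensityG t * ((g (-(-y)) - g (-(-y - t))) / t)) =
      fun t ↦ weilArchDensityG t * ((g y - g (y + t)) / t) := by
    funext t
    rw [neg_neg, show -(-y - t) = y + t by ring]
  rw [e1, e2, show c - -y = c + y by ring, show c + -y = c - y by ring] at h
  conv_rhs at h => rw [neg_neg]
  have hL := congrArg (fun f : ℝ → ℂ ↦ ∫ t in Ioi (0 : ℝ), f t) (dt_archSlice_reflect v y)
  exact hL.trans h

/-! ## The pole coefficients are real interval integrals -/

/-- `∫ v(x) cosh(x/2) dx = ↑(∫_{-c}^{c} g(x) cosh(x/2) dx)`. -/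
theorem dt_poleCoeff_cosh (hc : 0 < c) (hv : ∀ x, v x = (((Icc (-c) c).indicator g x : ℝ) : ℂ)) :
    ∫ x, v x * (Real.cosh (x / 2) : ℂ) = ((∫ x in (-c)..c, g x * Real.cosh (x / 2) : ℝ) : ℂ) := by
  have e : (fun x ↦ v x * (Real.cosh (x / 2) : ℂ)) =
      fun x ↦ (((Icc (-c) c).indicator (fun x ↦ g x * Real.cosh (x / 2)) x : ℝ) : ℂ) := by
    funext x
    rw [hv]
    by_cases hx : x ∈ Icc (-c) c
    · rw [indicator_of_mem hx, indicator_of_mem hx]; push_cast; ring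
    · rw [indicator_of_notMem hx, indicator_of_notMem hx]; push_cast; ring
  rw [e, integral_complex_ofReal, integral_indicator measurableSet_Icc, integral_Icc_eq_integral_Ioc,
    intervalIntegral.integral_of_le (by linarith)]

/-- `∫ v(x) sinh(x/2) dx = ↑(∫_{-c}^{c} g(x) sinh(x/2) dx)`. -/
theorem dt_poleCoeff_sinh (hc : 0 < c) (hv : ∀ x, v x = (((Icc (-c) c).indicator g x : ℝ) : ℂ)) :
    ∫ x, v x * (Real.sinh (x / 2) : ℂ) = ((∫ x in (-c)..c, g x * Real.sinh (x / 2) : ℝ) : ℂ) := by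
  have e : (fun x ↦ v x * (Real.sinh (x / 2) : ℂ)) =
      fun x ↦ (((Icc (-c) c).indicator (fun x ↦ g x * Real.sinh (x / 2)) x : ℝ) : ℂ) := by
    funext x
    rw [hv]
    by_cases hx : x ∈ Icc (-c) c
    · rw [indicator_of_mem hx, indicator_of_mem hx]; push_cast; ring
    · rw [indicator_of_notMem hx, indicator_of_notMem hx]; push_cast; ring
  rw [e, integral_complex_ofReal, integral_indicator measurableSet_Icc, integral_Icc_eq_integral_Ioc,
    intervalIntegral.integral_of_le (by linarith)]

/-! ## The whole window image on `[0, c)`, realified -/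

/-- **The window image of `𝟙_{[-c,c]}·g` at `0 ≤ y < c` as ONE REAL EXPRESSION**: pole part
`2P_c cosh(y/2) − 2P_s sinh(y/2)`, prime part `Σ_{log n<2c} Λ(n)n^{-1/2}(2g(y) − ĝ(y − log n) − ĝ(y + log n))`, the split
archimedean layer, and the killing term `−M_c g(y)` — the object the R-layer encloses panel by panel.
[cite: Bombieri2000Weil, Thm 2 (explicit formula: pole, prime and archimedean terms)] -/
theorem dt_windowImage_real (hc : 0 < c) (hg : ContDiff ℝ 2 g)
    (hv : ∀ x, v x = (((Icc (-c) c).indicator g x : ℝ) : ℂ)) {F : ℝ → ℂ}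
    (hF : ∀ y, F y = (Icc (-c) c).indicator (fun y ↦
        2 * (∫ x, v x * (Real.cosh (x / 2) : ℂ)) * (Real.cosh (y / 2) : ℂ) -
          2 * (∫ x, v x * (Real.sinh (x / 2) : ℂ)) * (Real.sinh (y / 2) : ℂ) +
        (∑ n ∈ weilPrimeIndex c, (((ArithmeticFunction.vonMangoldt n : ℝ) / Real.sqrt n : ℝ) : ℂ) *
          (2 * v y - v (y - Real.log n) - v (y + Real.log n))) +
        ∫ t in Ioi 0, (weilArchDensity t : ℂ) * (2 * v y - v (y - t) - v (y + t))) y -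
      (weilMarkovConstant c : ℂ) * v y)
    {y : ℝ} (hy : y ∈ Ico 0 c) :
    F y = ((2 * (∫ x in (-c)..c, g x * Real.cosh (x / 2)) * Real.cosh (y / 2) -
        2 * (∫ x in (-c)..c, g x * Real.sinh (x / 2)) * Real.sinh (y / 2) +
      (∑ n ∈ weilPrimeIndex c, ((ArithmeticFunction.vonMangoldt n : ℝ) / Real.sqrt n) *
        (2 * g y - (Icc (-c) c).indicator g (y - Real.log n) - (Icc (-c) c).indicator g (y + Real.log n))) +
      ((∫ t in Ioc 0 (c - y), weilArchDensityG t * ((2 * g y - g (y - t) - g (y + t)) / t)) +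
        (∫ t in Ioc (c - y) (c + y), weilArchDensityG t * ((g y - g (y - t)) / t)) +
        g y * ((∫ t in Ioi (c - y), weilArchDensity t) + ∫ t in Ioi (c + y), weilArchDensity t)) -
      weilMarkovConstant c * g y : ℝ) : ℂ) := by
  have hyI : y ∈ Icc (-c) c := ⟨by linarith [hy.1], hy.2.le⟩
  rw [hF y, indicator_of_mem hyI, dt_poleCoeff_cosh hc hv, dt_poleCoeff_sinh hc hv, dt_archImage_split hc hg hv hy]
  have hvy : v y = (g y : ℂ) := by rw [hv, dt_window_indicator_of_mem hyI]
  have hvs : ∀ s, v s = (((Icc (-c) c).indicator g s : ℝ) : ℂ) := hv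
  simp only [hvy, hvs]
  push_cast
  ring

end Summit.RiemannHypothesis.RiemannHypothesis.Theorems.EvenWinsBeyondArch

end
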